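import Summits.ResolutionOfSingularities.ResolutionOfSingularities.Theorems.PurelyInseparableDim4ResConeShadeTwoFrameWindow
import HarnessLib
import HarnessLib.Audit.Tags

/-!
# Purely inseparable four-folds — K2(p), PHASE `d = 2`, PART XII: the frame-window transfer on a LOCAL honest window (six states,
# per-index hypotheses; every prime) — the consumer form for swap normalisation

[OURS · counted 0 · cell `res-dim4-pi` · seat res-dim4-p-7 g3 · K2(p) lane (holder res-dim4-p-12 lineage; desk WORDs #82 (c),
#96 (a)).]  Nothing here proves K2(p), `NoIsolatedTrap p p`, or resolution of singularities in dimension ≥ 4 / characteristic `p`.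
AI kernel work, weaker than expert review.

PART XI's `no_light_switch_window` is stated along an infinite witnessed chain.  The remaining `d = 2` residue («the trap swaps its
free letter infinitely often», `shadeTwo_swaps_recur`) calls for RE-PRESENTING finite windows that contain swap steps; a
re-presented window is no longer a segment of the original chain, so this file re-plumbs the transfer for a LOCAL honest window:
six presented states `s 0, …, s 5`, honest steps `s (i+1) = step p univ (j i) (β i) (s i)` (`i ≤ 4`) with `β i (j i) = 0` and `β i`
supported on the free letter `f`, each state isolated with `x^r ∣ F`, `ord₀ F = |r| + 2`, `|r| + 1 = p`, `r_f = 0`, `(s 0).F` clean,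
`x_f²` in the quadric at `s 0, …, s 4`, charts `j 0 = u`, `j 1 = v` (`u ≠ v`, both `≠ f`), `j 2, j 3, j 4 ∈ {u, v}`, `v` light at `s 1`,
`u` light at `s 2` ⇒ **`no_light_switch_window_local`**: contradiction (`p ≥ 5`, `CharP K p`).
bears_on: LADDER-RESOLUTION:D157-DOOR2 (res-dim4-pi · K2(p) · phase d = 2).  Supports stmt-ResolutionOfSingularities-16155
(helper).
-/

set_option linter.dupNamespace false -- mandated namespace of this single-conjunct summit

noncomputable section

namespace Summit.ResolutionOfSingularities.ResolutionOfSingularities.Theorems.PIDim4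

namespace ResCone

open MvPolynomial Finset
open Literature.AlgebraicGeometry.Resolution
open Literature.AlgebraicGeometry.Resolution.CentreBlowup
open Literature.AlgebraicGeometry.Resolution.Hauser2010
open Literature.AlgebraicGeometry.Resolution.HauserPerlega2019
open FrameChange
open PointBlowup (translate)

variable {K : Type} [Field K] [DecidableEq K]

variable {p : ℕ} [hp : Fact p.Prime] {s : ℕ → State K} {j : ℕ → Fin 4} {β : ℕ → Fin 4 → K}

/-- **LIGHT SWITCHES DIE WITHIN FOUR STEPS — LOCAL WINDOW.**  Six presented states `s 0, …, s 5` joined by honest steps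
`s (i+1) = step p univ (j i) (β i) (s i)` (`i ≤ 4`, `β i (j i) = 0`, `β i` supported on `f`), each isolated with `x^r ∣ F`,
`ord₀ F = |r| + 2`, `|r| + 1 = p`, `r_f = 0`; `(s 0).F` clean; `x_f²` in the quadric at `s 0, …, s 4`; charts `j 0 = u`, `j 1 = v`
(`u ≠ v`, both `≠ f`), `j 2, j 3, j 4 ∈ {u, v}`; `v` light at `s 1`, `u` light at `s 2`; `p ≥ 5` — is impossible: the straight
frame of PART XI at `s 0`, pushed along the window (matching lemma), presents it as a local corner window (PART IX).
[OURS · K2(p) phase d = 2] [cite: Hauser2010, §§F–G] [folklore] -/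
theorem no_light_switch_window_local [CharP K p] (h5 : 5 ≤ p) {f u v : Fin 4} (huv : u ≠ v) (huf : u ≠ f) (hvf : v ≠ f)
    (hS : ∀ i, i ≤ 5 → IsIsolated p (s i).F ∧ (∀ e ∈ (s i).F.support, (s i).r ≤ e) ∧
      ordZero (s i).F = (((s i).r.degree + 2 : ℕ) : ℕ∞) ∧ (s i).r.degree + 1 = p ∧ (s i).r f = 0)
    (hcl : deletePthPowers p (s 0).F = (s 0).F)
    (hT : ∀ i, i ≤ 4 → s (i + 1) = CentreBlowup.step p Finset.univ (j i) (β i) (s i) ∧ β i (j i) = 0 ∧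
      ∀ i', i' ≠ f → β i i' = 0)
    (hsq : ∀ i, i ≤ 4 → coeff (Finsupp.single f 2) (resForm (s i)) ≠ 0)
    (hrv1 : (s 1).r v = 1) (hru2 : (s 2).r u = 1)
    (hju : j 0 = u) (hjv : j 1 = v) (hj2 : j 2 = u ∨ j 2 = v) (hj3 : j 3 = u ∨ j 3 = v) (hj4 : j 4 = u ∨ j 4 = v) :
    False := by
  classical
  -- constants
  have h2 : (2 : K) ≠ 0 := by
    intro h
    have h' : ((2 : ℕ) : K) = 0 := by rw [Nat.cast_ofNat]; exact h
    rw [CharP.cast_eq_zero_iff K p] at h'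
    have := Nat.le_of_dvd (by norm_num) h'
    omega
  have hjf : ∀ i, i ≤ 4 → j i ≠ f := by
    intro i hi
    interval_cases i
    · rw [hju]; exact huf
    · rw [hjv]; exact hvf
    · rcases hj2 with h | h <;> rw [h]
      exacts [huf, hvf]
    · rcases hj3 with h | h <;> rw [h]
      exacts [huf, hvf]
    · rcases hj4 with h | h <;> rw [h]
      exacts [huf, hvf]
  have hpo : ∀ i, i ≤ 5 → ¬ p ∣ (s i).r.degree + 2 := by
    intro i hi hdvd
    rw [show (s i).r.degree + 2 = p + 1 by have := (hS i hi).2.2.2.1; omega, Nat.dvd_add_right (dvd_refl p),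
      Nat.dvd_one] at hdvd
    exact hp.out.one_lt.ne' hdvd
  have hclean : ∀ i, i ≤ 5 → deletePthPowers p (s i).F = (s i).F := by
    intro i hi
    rcases i with _ | i
    · exact hcl
    · rw [(hT i (by omega)).1]; exact deletePthPowers_step_F p _ _ _ _
  -- the honest steps keep the shade and the band
  have hfact : ∀ i, i ≤ 4 → (CentreBlowup.step p Finset.univ (j i) (β i) (s i)).shade = (s i).shade ∧
      p ≤ (s i).r.degree + 1 ∧ (s i).r.degree + 4 ≤ 2 * p := by
    intro i hi
    obtain ⟨-, -, ho, hW, -⟩ := hS i (by omega)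
    obtain ⟨-, -, ho', hW', -⟩ := hS (i + 1) (by omega)
    refine ⟨?_, by omega, by omega⟩
    rw [← (hT i hi).1]
    unfold CState.shade
    rw [ho, ho']
    have e1 : (((s (i + 1)).r.degree + 2 : ℕ) : ℕ∞) - ((s (i + 1)).r.degree : ℕ∞) = 2 := by
      rw [← ENat.coe_sub, Nat.add_sub_cancel_left]; rfl
    have e2 : (((s i).r.degree + 2 : ℕ) : ℕ∞) - ((s i).r.degree : ℕ∞) = 2 := by
      rw [← ENat.coe_sub, Nat.add_sub_cancel_left]; rfl
    rw [e1, e2]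
  -- §1: the straight frame at `s 0`
  obtain ⟨-, hr_0, ho_0, -, hrf0⟩ := hS 0 (by norm_num)
  obtain ⟨φ₀, h00, hφ0, hstr0⟩ := exists_straight_frame (s := s 0) rfl ho_0 hr_0 hrf0 (hsq 0 (by norm_num)) h2 5
  -- the data: pushed frames and the frame states
  let φ : ℕ → MvPolynomial (Fin 4) K := fun i => Nat.rec φ₀ (fun i ψ =>
    translate (0 : Fin 4 → K) (chartTransform 1 Finset.univ (j i) ψ) -
      C (MvPolynomial.eval (0 : Fin 4 → K) (chartTransform 1 Finset.univ (j i) ψ))) i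
  have hφs : ∀ i, φ (i + 1) = translate (0 : Fin 4 → K) (chartTransform 1 Finset.univ (j i) (φ i)) -
      C (MvPolynomial.eval (0 : Fin 4 → K) (chartTransform 1 Finset.univ (j i) (φ i))) := fun i => rfl
  let S : ℕ → State K := fun i => Nat.rec
    (⟨deletePthPowers p (tsch f φ₀ (s 0).F), (s 0).r, (s 0).exc⟩ : State K)
    (fun i t => CentreBlowup.step p Finset.univ (j i) (0 : Fin 4 → K) t) i
  have hSs : ∀ i, S (i + 1) = CentreBlowup.step p Finset.univ (j i) (0 : Fin 4 → K) (S i) := fun i => rfl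
  -- admissibility of the pushed frames on the window
  have hadm : ∀ i, i ≤ 5 → f ∉ (φ i).vars ∧ constantCoeff (φ i) = 0 := by
    intro i hi
    induction i with
    | zero => exact ⟨hφ0, h00⟩
    | succ i ih =>
      have ih' := ih (by omega)
      rw [hφs]
      exact ⟨not_mem_vars_tschShift (not_mem_vars_chartTransform 1 _ (hjf i (by omega)) ih'.1) _,
        constantCoeff_tschShift _ _⟩
  -- THE INVARIANT: the frame states sit over the honest ones, straight to order `7 − i`
  have key : ∀ i, i ≤ 5 → (S i).F = deletePthPowers p (tsch f (φ i) (s i).F) ∧ (S i).r = (s i).r ∧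
      ∀ n : Fin 4 →₀ ℕ, (s i).r + n ∈ ((S i).F).support → n f = 1 → (5 - i) + 2 ≤ n.degree := by
    intro i hi
    induction i with
    | zero =>
      refine ⟨rfl, rfl, fun n hn hnf => ?_⟩
      exact hstr0 n (MohAlong.mem_support_of_mem_support_deletePthPowers p hn).1 hnf
    | succ i ih =>
      obtain ⟨hFi, hri, hStr⟩ := ih (by omega)
      have hi4 : i ≤ 4 := by omega
      obtain ⟨hψ, h0⟩ := hadm i (by omega)
      obtain ⟨hiso, hr_s, ho_s, hW, hrf⟩ := hS i (by omega)
      obtain ⟨hck, hbj, hb⟩ := hT i hi4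
      obtain ⟨heq, hpW, hW2⟩ := hfact i hi4
      have hq_s : (p : ℕ∞) ≤ ordZero (s i).F := by
        rw [ho_s]; exact_mod_cast (show p ≤ (s i).r.degree + 2 by omega)
      -- MATCHING
      have hmatch : MvPolynomial.eval (0 : Fin 4 → K) (chartTransform 1 Finset.univ (j i) (φ i)) = β i f := by
        refine frame_translation_eq p rfl ho_s hr_s hpW hW2 (hpo i (by omega)) hrf (hsq i hi4) h2
          (hjf i hi4) hbj hb heq h0 hψ ?_
        by_contra hne
        have hmem : (s i).r + (Finsupp.single (j i) 1 + Finsupp.single f 1) ∈ ((S i).F).support := by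
          rw [hFi]; exact MvPolynomial.mem_support_iff.mpr hne
        have h := hStr _ hmem
          (by rw [Finsupp.add_apply, Finsupp.single_apply, if_neg (hjf i hi4), Finsupp.single_eq_same])
        rw [map_add, Finsupp.degree_single, Finsupp.degree_single] at h
        omega
      have hbplus : Function.update (0 : Fin 4 → K) f ((0 : Fin 4 → K) f +
          MvPolynomial.eval (0 : Fin 4 → K) (chartTransform 1 Finset.univ (j i) (φ i))) = β i := by
        funext i'
        by_cases hi' : i' = f
        · rw [hi', Function.update_self, Pi.zero_apply, zero_add, hmatch]
        · rw [Function.update_of_ne hi', Pi.zero_apply, hb i' hi']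
      have hF' : (S (i + 1)).F = deletePthPowers p (tsch f (φ (i + 1)) (s (i + 1)).F) := by
        rw [hSs, hφs, step_F_of_cleanTsch p hFi hq_s (hjf i hi4) h0 0, hbplus, ← hck]
      have hr' : (S (i + 1)).r = (s (i + 1)).r := by
        rw [hSs, step_r_of_cleanTsch p hFi hri (hclean i (by omega)) hψ h0 hrf (j i) 0, hbplus, ← hck]
      refine ⟨hF', hr', fun n' hn' hn'f => ?_⟩
      have hW_i : (S i).r.degree = (s i).r.degree := by rw [hri]
      have ho_i : ordZero (S i).F = (((s i).r.degree + 2 : ℕ) : ℕ∞) := by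
        rw [hFi, ordZero_clean_tsch p hψ h0 (hclean i (by omega)), ho_s]
      have hr_i : ∀ e ∈ ((S i).F).support, (S i).r ≤ e := by
        rw [hFi, hri]; exact forall_le_of_mem_support_clean_tsch p hrf hr_s
      have hm' : (CentreBlowup.step p Finset.univ (j i) (0 : Fin 4 → K) (S i)).r + n' ∈
          (CentreBlowup.step p Finset.univ (j i) (0 : Fin 4 → K) (S i)).F.support := by
        rw [← hSs, hr']; exact hn'
      obtain ⟨n, hn, h2n, hn'eq⟩ := exists_source_of_corner (p := p) (j i) (S i) hW_i ho_i hr_i (by omega) hm'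
      rw [hri] at hn
      obtain ⟨-, hnoff⟩ := apply_of_eq_update hn'eq
      have hnf : n f = 1 := by rw [← hnoff f (hjf i hi4).symm]; exact hn'f
      have hdeg := hStr n hn hnf
      have hdeg' := degree_update_add n (j i) (n.degree - 2)
      rw [← hn'eq] at hdeg'
      have hle := apply_add_apply_le_degree n (hjf i hi4)
      omega
  -- the six frame states are an honest local corner window
  have hS' : ∀ i, i ≤ 5 → IsIsolated p (S i).F ∧ (∀ e ∈ (S i).F.support, (S i).r ≤ e) ∧
      ordZero (S i).F = (((S i).r.degree + 2 : ℕ) : ℕ∞) ∧ p ≤ (S i).r.degree + 1 ∧ (S i).r.degree + 4 ≤ 2 * p ∧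
      (S i).shade = 2 := by
    intro i hi
    obtain ⟨hFi, hri, -⟩ := key i hi
    obtain ⟨hψ, h0⟩ := hadm i hi
    obtain ⟨hiso, hr_s, ho_s, hW, hrf⟩ := hS i hi
    have ho_i : ordZero (S i).F = (((s i).r.degree + 2 : ℕ) : ℕ∞) := by
      rw [hFi, ordZero_clean_tsch p hψ h0 (hclean i hi), ho_s]
    refine ⟨?_, ?_, ?_, ?_, ?_, ?_⟩
    · rw [hFi]; exact (isIsolated_clean_tsch_iff p hψ h0 _).mpr hiso
    · rw [hFi, hri]; exact forall_le_of_mem_support_clean_tsch p hrf hr_s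
    · rw [ho_i, hri]
    · rw [hri]; omega
    · rw [hri]; omega
    · unfold CState.shade
      rw [ho_i, hri, ← ENat.coe_sub, Nat.add_sub_cancel_left]
      rfl
  have hT' : ∀ i, i ≤ 4 → S (i + 1) = CentreBlowup.step p Finset.univ (j i) (0 : Fin 4 → K) (S i) :=
    fun i _ => hSs i
  have hr1 : (S 1).r = (s 1).r := (key 1 (by norm_num)).2.1
  have hr2 : (S 2).r = (s 2).r := (key 2 (by norm_num)).2.1
  exact no_corner_switch_window_local (s := S) (j := j) hS' hT' huv
    (by rw [hr1]; exact (hS 1 (by norm_num)).2.2.2.1) (by rw [hr2]; exact (hS 2 (by norm_num)).2.2.2.1)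
    (by rw [hr1]; exact hrv1) (by rw [hr2]; exact hru2) hju hjv hj2 hj3 hj4

end ResCone

end Summit.ResolutionOfSingularities.ResolutionOfSingularities.Theorems.PIDim4

end
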